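import Summits.CriticalPhenomena.CardyFormulaZ2.Theorems.CardyBoundaryCoulombGasBoundaryDefectGaussianRStubRealisabilityPart31
import Summits.CriticalPhenomena.CardyFormulaZ2.Theorems.CardyBoundaryCoulombGasBoundaryDefectGaussianRStubRealisabilityPart32

/-!
# Stub `stub_realisability` of line `rainbow-monomials-in-excursion-kernels` — Part 33 (open-edge
# levels, 3/4): what the collar walk mentions, and when two mentions agree
# (crux `BoundaryDefectGaussianR`, stmt-CriticalPhenomena-14132; insertion dictionary D2)

Notation of Parts 7, 8, 13, 31. The prescribed level `vertH x` of an arc vertex or a ghost `x` is the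
value of the FIRST walk entry mentioning `x` (`LegInsertionData.mention`, Part 7 (D)); to show
that the two endpoints of an open edge get the same level one needs ALL mentions of a point to
agree. This file:

* `touch_of_mention` — an entry mentions only corners of the gap face of its dart (it TOUCHES them);
* `mention_value` — entry `t` mentions a point, if at all, with the level
  `λ t = (wired before ? level before : level after)` of the wired stretch through dart `t`;
  `wired_of_mention` — and then dart `t` lies on a wired stretch;
* `straight_three`, `wired_three` — with FLAT insertion points (radius `L + 3`), if one of three
  consecutive darts `t, t', t''` is active they are straight translates `(z, k)`, …,
  `(z + 2 • dir (k+1), k)`; otherwise the wiredness is constant from `st t` to `st (t'' + 1)`;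
* `mention_succ_eq` (PAIR 1), `mention_succ_succ_eq` (PAIR 2) — with FLAT insertion points, two
  mentions of the same point at consecutive entries, or at entries two apart, carry the same level
  (silent darts keep the level; active darts are straight pieces of footprints, which touch a
  common point only as "tip of the next dart", mentioned one dart early at the same level).
Registered sub-goal carried here: `s13_mentionPair`. Part 34 concludes.
-/

namespace Summit.CriticalPhenomena.CardyFormulaZ2.Cruxes.BoundaryDefectGaussianR.RainbowMonomialsInExcursionKernels

open Literature.Probability.LatticeModels Literature.Probability.LatticeModels.CollarLegModel

/-! ### Two straight darts touch disjoint sets of points -/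

/-- A dart and its straight translate do not share a vertex-or-tip with a touched point: if `x`
is the vertex or the tip of `(y, k)`, it is not a corner of the gap face of `(y + dir (k+1), k)`.
[folklore] -/
theorem not_touch_straight_one {y x : ℤ × ℤ} {k : Fin 4} (hx : x = y ∨ x = y + dir k)
    (ht : x ∈ SixVertex.faceCorners (gapFace (y + dir (k + 1), k))) : False := by
  rw [mem_faceCorners_gapFace] at ht
  obtain ⟨a, b⟩ := y
  obtain ⟨x₁, x₂⟩ := x
  rcases hx with h | h <;> rcases ht with h' | h' | h' | h' <;> fin_cases k <;>
    simp [dir, Prod.ext_iff] at h h' <;> omega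

/-- A dart and its second straight translate touch no common point. [folklore] -/
theorem not_touch_straight_two {y x : ℤ × ℤ} {k : Fin 4}
    (hx : x ∈ SixVertex.faceCorners (gapFace (y, k)))
    (ht : x ∈ SixVertex.faceCorners (gapFace (y + (2 : ℤ) • dir (k + 1), k))) : False := by
  rw [mem_faceCorners_gapFace] at hx ht
  obtain ⟨a, b⟩ := y
  obtain ⟨x₁, x₂⟩ := x
  rcases hx with h | h | h | h <;> rcases ht with h' | h' | h' | h' <;> fin_cases k <;>
    simp [dir, Prod.ext_iff] at h h' <;> omega

/-- Cyclic index arithmetic: the successor of the predecessor. [folklore] -/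
theorem succ_pred_mod {P t : ℕ} (ht : t < P) : ((t + P - 1) % P + 1) % P = t := by
  rcases Nat.eq_zero_or_pos t with rfl | hpos
  · rw [Nat.zero_add, Nat.mod_eq_of_lt (by omega : P - 1 < P), Nat.sub_add_cancel (by omega),
      Nat.mod_self]
  · rw [show t + P - 1 = (t - 1) + P by omega, Nat.add_mod_right,
      Nat.mod_eq_of_lt (by omega : t - 1 < P), Nat.sub_add_cancel hpos, Nat.mod_eq_of_lt ht]

/-- Cyclic index arithmetic: the predecessor of the successor. [folklore] -/
theorem pred_succ_mod {P t : ℕ} (ht : t < P) : ((t + 1) % P + P - 1) % P = t := by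
  by_cases hlt : t + 1 < P
  · rw [Nat.mod_eq_of_lt hlt, show t + 1 + P - 1 = t + P by omega, Nat.add_mod_right,
      Nat.mod_eq_of_lt ht]
  · rw [show t + 1 = P by omega, Nat.mod_self, Nat.zero_add, Nat.mod_eq_of_lt (by omega : P - 1 < P)]
    omega

/-! ### Mentions along the walk of an admissible datum -/

section Admissible

variable (ι : LegInsertionData) (V : Finset (ℤ × ℤ)) {d₀ : Dart} (hadm : ι.IsAdmissible V)
  (h : outDart V ι.sink = some d₀) {st : ℕ → WalkState}
  (hst : ∀ t, st t = List.foldl (fun s d => s.step (ι.startAt V d)) ι.init ((cycle V d₀).take t))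

/-- A walk entry mentions only points it touches (corners of the gap face of its dart). [folklore] -/
theorem touch_of_mention {x : ℤ × ℤ} {e : Dart × WalkState × WalkState}
    (hm : LegInsertionData.mention V x e ≠ none) : x ∈ SixVertex.faceCorners (gapFace e.1) := by
  obtain ⟨⟨u, k⟩, s₁, s₂⟩ := e
  rw [Ne, mention_eq_none_iff] at hm
  simp only [dartTip] at hm ⊢
  rw [mem_faceCorners_gapFace]
  by_contra hc
  apply hm
  refine ⟨fun hA => ?_, fun hB => hc ((mem_faceCorners_gapFace u x k).1 hB.2.1)⟩
  rcases hA.2 with h1 | h1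
  · exact hc (Or.inl h1.symm)
  · exact hc (Or.inr (Or.inl h1.symm))

include hst in
/-- **The value of a mention.** Entry `t` mentions a point, if at all, with the level
`λ t = (wired before ? level before : level after)` of the wired stretch through dart `t`
(a pocket-corner mention carries the level after the dart, which is `λ t`: a wired → wired dart
is silent). [folklore] -/
theorem mention_value {x : ℤ × ℤ} {t : ℕ} (ht : t < (cycle V d₀).length) {v : ℤ}
    (hm : LegInsertionData.mention V x ((cycle V d₀)[t], st t, st (t + 1)) = some v) :
    v = if (st t).wired = true then (st t).level else (st (t + 1)).level := by
  by_cases hA : ((st t).wired = true ∨ (st (t + 1)).wired = true) ∧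
      (((cycle V d₀)[t]).1 = x ∨ dartTip (cycle V d₀)[t] = x)
  · rw [mention_of_vertex V (e := ((cycle V d₀)[t], st t, st (t + 1))) hA.1 hA.2] at hm
    simpa using hm.symm
  · by_cases hB : (st (t + 1)).wired = true ∧
        x ∈ SixVertex.faceCorners (gapFace (cycle V d₀)[t]) ∧ x ∉ V
    · have hne : ((cycle V d₀)[t]).1 ≠ x ∧ dartTip (cycle V d₀)[t] ≠ x := by
        constructor <;> intro hh <;> exact hA ⟨Or.inr hB.1, by simp [hh]⟩
      rw [mention_of_pocketCorner V (e := ((cycle V d₀)[t], st t, st (t + 1))) hne hB.1 hB.2.1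
        hB.2.2] at hm
      simp only [Option.some.injEq] at hm
      rw [← hm]
      split_ifs with hw
      · -- wired before and after: the dart is silent
        rcases st_step_cases ι V hst ht with hs | ⟨-, ⟨-, hw'⟩ | ⟨-, hw', -⟩⟩
        · exact hs.1
        · rw [hw, hB.1] at hw'; exact absurd hw' (by decide)
        · rw [hw] at hw'; exact absurd hw' (by decide)
      · rfl
    · exact absurd ((mention_eq_none_iff V).2 ⟨hA, hB⟩) (by rw [hm]; simp)

/-- An entry that mentions something lies on a wired stretch (before or after its dart). [folklore] -/
theorem wired_of_mention {x : ℤ × ℤ} {t : ℕ} (ht : t < (cycle V d₀).length)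
    (hm : LegInsertionData.mention V x ((cycle V d₀)[t], st t, st (t + 1)) ≠ none) :
    (st t).wired = true ∨ (st (t + 1)).wired = true := by
  rw [Ne, mention_eq_none_iff] at hm
  by_contra hw
  exact hm ⟨fun hA => hw hA.1, fun hB => hw (Or.inr hB.1)⟩

include hadm h hst in
/-- **Three consecutive darts, one of them active, are straight translates.** With flat insertion
points: if one of the darts `t`, `t' = (t+1) % P`, `t'' = (t'+1) % P` is active, then
`ds[t] = (z, k)` and `ds[t''] = (z + 2 • dir (k+1), k)` for some `z, k`. [folklore] -/
theorem straight_three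
    (hflat : ∀ x ∈ insert ι.sink ι.source, ∃ dvec : ℤ × ℤ,
      (dvec = (1, 0) ∨ dvec = (-1, 0) ∨ dvec = (0, 1) ∨ dvec = (0, -1)) ∧
      ∀ v : ℤ × ℤ, (v.1 - x.1) ^ 2 + (v.2 - x.2) ^ 2 ≤ ((ι.sinkLegs : ℤ) + 3) ^ 2 →
        (v ∈ V ↔ 0 ≤ (v.1 - x.1) * dvec.1 + (v.2 - x.2) * dvec.2))
    {t : ℕ} (ht : t < (cycle V d₀).length)
    (hact : ¬ (((st (t + 1)).level = (st t).level ∧ (st (t + 1)).wired = (st t).wired) ∧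
      ((st ((t + 1) % (cycle V d₀).length + 1)).level = (st ((t + 1) % (cycle V d₀).length)).level ∧
        (st ((t + 1) % (cycle V d₀).length + 1)).wired = (st ((t + 1) % (cycle V d₀).length)).wired) ∧
      ((st (((t + 1) % (cycle V d₀).length + 1) % (cycle V d₀).length + 1)).level =
          (st (((t + 1) % (cycle V d₀).length + 1) % (cycle V d₀).length)).level ∧
        (st (((t + 1) % (cycle V d₀).length + 1) % (cycle V d₀).length + 1)).wired =
          (st (((t + 1) % (cycle V d₀).length + 1) % (cycle V d₀).length)).wired))) :
    ∃ (z : ℤ × ℤ) (k : Fin 4), (cycle V d₀)[t] = (z, k) ∧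
      (cycle V d₀)[((t + 1) % (cycle V d₀).length + 1) % (cycle V d₀).length]'
        (Nat.mod_lt _ (length_cycle_pos ι V hadm h)) = (z + (2 : ℤ) • dir (k + 1), k) := by
  have hP := length_cycle_pos ι V hadm h
  have ht' : (t + 1) % (cycle V d₀).length < (cycle V d₀).length := Nat.mod_lt _ hP
  have ht'' : ((t + 1) % (cycle V d₀).length + 1) % (cycle V d₀).length < (cycle V d₀).length := Nat.mod_lt _ hP
  by_cases h1 : (st (t + 1)).level = (st t).level ∧ (st (t + 1)).wired = (st t).wired
  · by_cases h2 : (st ((t + 1) % (cycle V d₀).length + 1)).level = (st ((t + 1) % (cycle V d₀).length)).level ∧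
        (st ((t + 1) % (cycle V d₀).length + 1)).wired = (st ((t + 1) % (cycle V d₀).length)).wired
    · have h3 : ¬ ((st (((t + 1) % (cycle V d₀).length + 1) % (cycle V d₀).length + 1)).level = (st (((t + 1) % (cycle V d₀).length + 1) % (cycle V d₀).length)).level ∧
          (st (((t + 1) % (cycle V d₀).length + 1) % (cycle V d₀).length + 1)).wired = (st (((t + 1) % (cycle V d₀).length + 1) % (cycle V d₀).length)).wired) :=
        fun h3 => hact ⟨h1, h2, h3⟩
      -- dart `t''` active
      obtain ⟨y, k, hy0, -, -, hy1, hy2⟩ := straight_of_active ι V hadm h hst hflat ht'' h3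
      refine ⟨y - (2 : ℤ) • dir (k + 1), k, ?_, ?_⟩
      · have e1 : (((t + 1) % (cycle V d₀).length + 1) % (cycle V d₀).length + (cycle V d₀).length - 1) % (cycle V d₀).length = (t + 1) % (cycle V d₀).length := pred_succ_mod ht'
        have e2 : ((t + 1) % (cycle V d₀).length + (cycle V d₀).length - 1) % (cycle V d₀).length = t := pred_succ_mod ht
        simp only [e1] at hy2
        simp only [e2] at hy2
        exact hy2
      · rw [hy0, sub_add_cancel]
    · -- dart `t'` active
      obtain ⟨y, k, -, hy1, -, hy2, -⟩ := straight_of_active ι V hadm h hst hflat ht' h2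
      refine ⟨y - dir (k + 1), k, ?_, ?_⟩
      · have e2 : ((t + 1) % (cycle V d₀).length + (cycle V d₀).length - 1) % (cycle V d₀).length = t := pred_succ_mod ht
        simp only [e2] at hy2
        exact hy2
      · rw [hy1]
        refine Prod.ext ?_ rfl
        simp only [two_smul]
        abel
  · -- dart `t` active
    obtain ⟨y, k, hy0, -, hy2, -, -⟩ := straight_of_active ι V hadm h hst hflat ht h1
    exact ⟨y, k, hy0, hy2⟩

include hadm h hst in
/-- **Consecutive mentions agree (PAIR 1).** With flat insertion points, if entries `t` and
`(t+1) % P` both mention `x`, the two values agree. (The only delicate case — both darts active,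
a wired arc closed and reopened at once lower level — is a straight piece of a footprint, whose
two darts have no common vertex or tip.) [folklore] -/
theorem mention_succ_eq
    (hflat : ∀ x ∈ insert ι.sink ι.source, ∃ dvec : ℤ × ℤ,
      (dvec = (1, 0) ∨ dvec = (-1, 0) ∨ dvec = (0, 1) ∨ dvec = (0, -1)) ∧
      ∀ v : ℤ × ℤ, (v.1 - x.1) ^ 2 + (v.2 - x.2) ^ 2 ≤ ((ι.sinkLegs : ℤ) + 3) ^ 2 →
        (v ∈ V ↔ 0 ≤ (v.1 - x.1) * dvec.1 + (v.2 - x.2) * dvec.2))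
    {x : ℤ × ℤ} {t : ℕ} (ht : t < (cycle V d₀).length) {v₁ v₂ : ℤ}
    (hm₁ : LegInsertionData.mention V x ((cycle V d₀)[t], st t, st (t + 1)) = some v₁)
    (hm₂ : LegInsertionData.mention V x
      ((cycle V d₀)[(t + 1) % (cycle V d₀).length]'(Nat.mod_lt _ (length_cycle_pos ι V hadm h)),
        st ((t + 1) % (cycle V d₀).length), st ((t + 1) % (cycle V d₀).length + 1)) = some v₂) :
    v₁ = v₂ := by
  have hP := length_cycle_pos ι V hadm h
  have ht' : (t + 1) % (cycle V d₀).length < (cycle V d₀).length := Nat.mod_lt _ hP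
  have hv₁ := mention_value ι V hst ht hm₁
  have hv₂ := mention_value ι V hst ht' hm₂
  obtain ⟨hsl, hsw⟩ := st_mod_succ ι V hadm h hst ht
  have hstep := st_step_cases ι V hst ht
  have hstep' := st_step_cases ι V hst ht'
  have hw₂ := wired_of_mention V ht' (by rw [hm₂]; simp)
  rw [hv₁, hv₂]
  cases hw0 : (st t).wired <;> cases hw1 : (st (t + 1)).wired
  · -- free before and after dart `t`: nothing is mentioned at `t`
    have := wired_of_mention V ht (by rw [hm₁]; simp)
    rw [hw0, hw1] at this
    simp at this
  · -- junction opening at `t`: both values are the level after dart `t`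
    rw [hsw, hw1, if_pos rfl, hsl]
    simp
  · -- junction closing at `t`, and dart `t'` is an opening junction: a straight footprint piece
    exfalso
    rw [hsw, hw1] at hw₂
    simp only [Bool.false_eq_true, false_or] at hw₂
    have hact : ¬ ((st (t + 1)).level = (st t).level ∧ (st (t + 1)).wired = (st t).wired) := by
      rw [hw0, hw1]; simp
    obtain ⟨y, k, hy0, hy1, -, -, -⟩ := straight_of_active ι V hadm h hst hflat ht hact
    -- `x` is the vertex or the tip of dart `t` (a pocket-corner mention needs a wired after-state)
    have hxA : x = y ∨ x = y + dir k := by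
      have hne : LegInsertionData.mention V x ((cycle V d₀)[t], st t, st (t + 1)) ≠ none := by
        rw [hm₁]; simp
      rw [Ne, mention_eq_none_iff, hy0] at hne
      simp only [hw1, dartTip] at hne
      by_contra hc
      apply hne
      refine ⟨fun hA => ?_, fun hB => by simp at hB⟩
      rcases hA.2 with h1 | h1
      · exact hc (Or.inl h1.symm)
      · exact hc (Or.inr h1.symm)
    have htouch := touch_of_mention V (e := ((cycle V d₀)[(t + 1) % (cycle V d₀).length], st ((t + 1) % (cycle V d₀).length),
      st ((t + 1) % (cycle V d₀).length + 1))) (by rw [hm₂]; simp)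
    simp only at htouch
    rw [hy1] at htouch
    exact not_touch_straight_one hxA htouch
  · -- wired before and after dart `t`: dart `t` is silent
    rw [if_pos rfl, hsw, hw1, if_pos rfl, hsl]
    rcases hstep with hs | ⟨-, ⟨-, hw'⟩ | ⟨-, hw', -⟩⟩
    · exact hs.1.symm
    · rw [hw0, hw1] at hw'; exact absurd hw' (by decide)
    · rw [hw0] at hw'; exact absurd hw' (by decide)

include hadm h hst in
/-- **Mentions two darts apart agree (PAIR 2).** With flat insertion points, if entries `t` and
`((t+1) % P + 1) % P` both mention `x`, the two values agree: either the three darts are silent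
(one level throughout) or they are straight translates touching no common point. [folklore] -/
theorem mention_succ_succ_eq
    (hflat : ∀ x ∈ insert ι.sink ι.source, ∃ dvec : ℤ × ℤ,
      (dvec = (1, 0) ∨ dvec = (-1, 0) ∨ dvec = (0, 1) ∨ dvec = (0, -1)) ∧
      ∀ v : ℤ × ℤ, (v.1 - x.1) ^ 2 + (v.2 - x.2) ^ 2 ≤ ((ι.sinkLegs : ℤ) + 3) ^ 2 →
        (v ∈ V ↔ 0 ≤ (v.1 - x.1) * dvec.1 + (v.2 - x.2) * dvec.2))
    {x : ℤ × ℤ} {t : ℕ} (ht : t < (cycle V d₀).length) {v₁ v₂ : ℤ}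
    (hm₁ : LegInsertionData.mention V x ((cycle V d₀)[t], st t, st (t + 1)) = some v₁)
    (hm₂ : LegInsertionData.mention V x
      ((cycle V d₀)[((t + 1) % (cycle V d₀).length + 1) % (cycle V d₀).length]'
          (Nat.mod_lt _ (length_cycle_pos ι V hadm h)),
        st (((t + 1) % (cycle V d₀).length + 1) % (cycle V d₀).length),
        st (((t + 1) % (cycle V d₀).length + 1) % (cycle V d₀).length + 1)) = some v₂) :
    v₁ = v₂ := by
  have hP := length_cycle_pos ι V hadm h
  have ht' : (t + 1) % (cycle V d₀).length < (cycle V d₀).length := Nat.mod_lt _ hP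
  have ht'' : ((t + 1) % (cycle V d₀).length + 1) % (cycle V d₀).length < (cycle V d₀).length := Nat.mod_lt _ hP
  by_cases hsil : ((st (t + 1)).level = (st t).level ∧ (st (t + 1)).wired = (st t).wired) ∧
      ((st ((t + 1) % (cycle V d₀).length + 1)).level = (st ((t + 1) % (cycle V d₀).length)).level ∧
        (st ((t + 1) % (cycle V d₀).length + 1)).wired = (st ((t + 1) % (cycle V d₀).length)).wired) ∧
      ((st (((t + 1) % (cycle V d₀).length + 1) % (cycle V d₀).length + 1)).level = (st (((t + 1) % (cycle V d₀).length + 1) % (cycle V d₀).length)).level ∧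
        (st (((t + 1) % (cycle V d₀).length + 1) % (cycle V d₀).length + 1)).wired = (st (((t + 1) % (cycle V d₀).length + 1) % (cycle V d₀).length)).wired)
  · obtain ⟨⟨h1l, -⟩, ⟨h2l, -⟩, ⟨h3l, -⟩⟩ := hsil
    have hv₁ := mention_value ι V hst ht hm₁
    have hv₂ := mention_value ι V hst ht'' hm₂
    obtain ⟨hsl, -⟩ := st_mod_succ ι V hadm h hst ht
    obtain ⟨hsl', -⟩ := st_mod_succ ι V hadm h hst ht'
    rw [hv₁, hv₂]
    split_ifs <;> omega
  · exfalso
    obtain ⟨z, k, hz0, hz2⟩ := straight_three ι V hadm h hst hflat ht hsil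
    have ht₁ := touch_of_mention V (e := ((cycle V d₀)[t], st t, st (t + 1))) (by rw [hm₁]; simp)
    have ht₂ := touch_of_mention V (e := ((cycle V d₀)[((t + 1) % (cycle V d₀).length + 1) % (cycle V d₀).length],
      st (((t + 1) % (cycle V d₀).length + 1) % (cycle V d₀).length), st (((t + 1) % (cycle V d₀).length + 1) % (cycle V d₀).length + 1))) (by rw [hm₂]; simp)
    simp only at ht₁ ht₂
    rw [hz0] at ht₁
    rw [hz2] at ht₂
    exact not_touch_straight_two ht₁ ht₂

include hadm h hst in
/-- **Three consecutive darts: straight, or of constant wiredness.** With flat insertion points,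
for darts `t`, `t' = (t+1) % P`, `t'' = (t'+1) % P`: either `ds[t] = (z, k)` and
`ds[t''] = (z + 2 • dir (k+1), k)` (one of them is active), or all three are silent and the
wiredness is the same before dart `t`, after it, before dart `t''` and after it. [folklore] -/
theorem wired_three
    (hflat : ∀ x ∈ insert ι.sink ι.source, ∃ dvec : ℤ × ℤ,
      (dvec = (1, 0) ∨ dvec = (-1, 0) ∨ dvec = (0, 1) ∨ dvec = (0, -1)) ∧
      ∀ v : ℤ × ℤ, (v.1 - x.1) ^ 2 + (v.2 - x.2) ^ 2 ≤ ((ι.sinkLegs : ℤ) + 3) ^ 2 →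
        (v ∈ V ↔ 0 ≤ (v.1 - x.1) * dvec.1 + (v.2 - x.2) * dvec.2))
    {t : ℕ} (ht : t < (cycle V d₀).length) :
    (∃ (z : ℤ × ℤ) (k : Fin 4), (cycle V d₀)[t] = (z, k) ∧
      (cycle V d₀)[((t + 1) % (cycle V d₀).length + 1) % (cycle V d₀).length]'
        (Nat.mod_lt _ (length_cycle_pos ι V hadm h)) = (z + (2 : ℤ) • dir (k + 1), k)) ∨
    ((st (t + 1)).wired = (st t).wired ∧
      (st (((t + 1) % (cycle V d₀).length + 1) % (cycle V d₀).length)).wired = (st t).wired ∧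
      (st (((t + 1) % (cycle V d₀).length + 1) % (cycle V d₀).length + 1)).wired = (st t).wired) := by
  have hP := length_cycle_pos ι V hadm h
  by_cases hsil : ((st (t + 1)).level = (st t).level ∧ (st (t + 1)).wired = (st t).wired) ∧
      ((st ((t + 1) % (cycle V d₀).length + 1)).level = (st ((t + 1) % (cycle V d₀).length)).level ∧
        (st ((t + 1) % (cycle V d₀).length + 1)).wired = (st ((t + 1) % (cycle V d₀).length)).wired) ∧
      ((st (((t + 1) % (cycle V d₀).length + 1) % (cycle V d₀).length + 1)).level =
          (st (((t + 1) % (cycle V d₀).length + 1) % (cycle V d₀).length)).level ∧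
        (st (((t + 1) % (cycle V d₀).length + 1) % (cycle V d₀).length + 1)).wired =
          (st (((t + 1) % (cycle V d₀).length + 1) % (cycle V d₀).length)).wired)
  · right
    obtain ⟨⟨-, h1w⟩, ⟨-, h2w⟩, ⟨-, h3w⟩⟩ := hsil
    obtain ⟨-, hsw⟩ := st_mod_succ ι V hadm h hst ht
    obtain ⟨-, hsw'⟩ := st_mod_succ ι V hadm h hst (Nat.mod_lt (t + 1) hP)
    refine ⟨h1w, ?_, ?_⟩
    · rw [hsw', h2w, hsw, h1w]
    · rw [h3w, hsw', h2w, hsw, h1w]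
  · left
    exact straight_three ι V hadm h hst hflat ht hsil

end Admissible

/-! ### Registered one-line form -/

/-- **Sub-goal `s13_mentionPair`** (registered on stmt-CriticalPhenomena-14132): PAIR 1 — for an
admissible insertion with flat insertion points, two mentions of the same point at consecutive
entries of the collar walk carry the same level. [folklore] -/
theorem s13_mentionPair : ∀ (ι : Literature.Probability.LatticeModels.CollarLegModel.LegInsertionData) (V : Finset (ℤ × ℤ)) (d₀ : Literature.Probability.LatticeModels.CollarLegModel.Dart) (st : ℕ → Literature.Probability.LatticeModels.CollarLegModel.WalkState), ι.IsAdmissible V → Literature.Probability.LatticeModels.CollarLegModel.outDart V ι.sink = some d₀ → (∀ t, st t = List.foldl (fun s d => s.step (ι.startAt V d)) ι.init ((Literature.Probability.LatticeModels.CollarLegModel.cycle V d₀).take t)) → (∀ x ∈ insert ι.sink ι.source, ∃ dvec : ℤ × ℤ, (dvec = (1, 0) ∨ dvec = (-1, 0) ∨ dvec = (0, 1) ∨ dvec = (0, -1)) ∧ ∀ v : ℤ × ℤ, (v.1 - x.1) ^ 2 + (v.2 - x.2) ^ 2 ≤ ((ι.sinkLegs : ℤ) + 3) ^ 2 → (v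 ∈ V ↔ 0 ≤ (v.1 - x.1) * dvec.1 + (v.2 - x.2) * dvec.2)) → ∀ (x : ℤ × ℤ) (t : ℕ) (ht : t < (Literature.Probability.LatticeModels.CollarLegModel.cycle V d₀).length) (ht' : (t + 1) % (Literature.Probability.LatticeModels.CollarLegModel.cycle V d₀).length < (Literature.Probability.LatticeModels.CollarLegModel.cycle V d₀).length) (v₁ v₂ : ℤ), Literature.Probability.LatticeModels.CollarLegModel.LegInsertionData.mention V x ((Literature.Probability.LatticeModels.CollarLegModel.cycle V d₀)[t], st t, st (t + 1)) = some v₁ → Literature.Probability.LatticeModels.CollarLegModel.LegInsertionData.mention V x ((Literature.Probability.LatticeModels.CollarLegModel.cycle V d₀)[(t + 1) % (Literature.Probability.LatticeModels.CollarLegModel.cycle V d₀).length], st ((t + 1) % (Literature.Probability.LatticeModels.CollarLegModel.cycle V d₀).length), st ((t + 1) % (Literature.Probability.LatticeModels.CollarLegModel.cycle V d₀).length + 1)) = some v₂ → v₁ = v₂ :=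
  fun ι V _ _ hadm h hst hflat _ _ ht _ _ _ hm₁ hm₂ => mention_succ_eq ι V hadm h hst hflat ht hm₁ hm₂

end Summit.CriticalPhenomena.CardyFormulaZ2.Cruxes.BoundaryDefectGaussianR.RainbowMonomialsInExcursionKernels
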